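import Summits.Ventures.CertifiedManyBodySolver.Downfold.RouterWordScoreEphMixTypings

/-!
# «BARE ∣ COMPOUND» typings in closed form: one bare head `q₁` and one compound word `q₂ + q₁` (any head alphabet)
# (seat hubbard-downfold-score-2 gen 23; generalises `score_ephmix` of `RouterWordScoreEphMixTypings.lean` p764933;
# filed BEFORE the record of VSET v5 M154 PbMo₆S₈, typed «EPH ∣ UND:MULTIORB+EPH», score-2 block57 2026-08-31T03:3xZ)

Venture CertifiedManyBodySolver, cell `pub/hubbard-downfold`; namespace `Summit.Ventures.CertifiedManyBodySolver.Downfold.RouterScore`.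
Everything here is PROVED (no `sorry`, standard axioms); nothing here is physics.

Several v5 / v8 rows carry a typing of the shape `[[q₁], [q₂, q₁]]`: a BARE branch word `q₁` OR a compound word led by a second
head `q₂` with `q₁` riding — EPHMIX «EPH ∣ UND:MIXED+EPH» (M376 ThIr₃, M499 TlNi₂Se₂; p764933), and tonight «EPH ∣ UND:MULTIORB+EPH»
(M154 PbMo₆S₈, Chevrel phase; run-6 g19 PACKAGE 2, lead g39 R-abk). §1 proves the closed form ONCE over any head alphabet
(`outcome_bare_compound`): structural-led ⇒ `ABSTAIN_structure` · led by `q₁`, or led by `q₂` WITH `q₁` riding ⇒ `AGREE` · otherwise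
`PARTIAL` iff `p = q₂` (the rider-less compound head) or `q₁` / `q₂` rides, else `DISAGREE`. §2 instantiates it on the router's heads:
`ephMulti` (PbMo₆S₈) with its `AGREE` characterisation and the block57 desk table, and RE-DERIVES `score_ephmix` from §1 as a
consistency check (`score_ephmix_again`). §3 records what the typing choice decides between the two instances: a Mo-4d k-head print
«UND:MULTIORB+EPH» is AGREE under «EPH ∣ UND:MULTIORB+EPH» and PARTIAL under EPHMIX, and symmetrically for the straddle print — the
sentence behind block57's «(a) straddle ⇒ PARTIAL = the live shape; (b) k-head + EPH ⇒ AGREE (typed)».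

WHAT THIS IS NOT: not a statement about PbMo₆S₈ or any material, not a typing ruling (the words are the curators' and the lead's) and not
the scorer of record — the kernel form of the §4.2 letter on this typing shape, so that receipts on it are mechanical sentences.
-/

namespace Summit.Ventures.CertifiedManyBodySolver.Downfold

namespace RouterScore

/-! ## §1 «BARE ∣ COMPOUND» in closed form (any head alphabet) -/

section general

variable {α : Type*} [DecidableEq α] (structural : α → Bool)

omit [DecidableEq α] in
/-- the typing `[[q₁], [q₂, q₁]]` with both heads non-structural expects no structural primary. [folklore] -/
theorem expectsStructural_bare_compound {q₁ q₂ : α} (h₁ : structural q₁ = false) (h₂ : structural q₂ = false) :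
    expectsStructural structural [[q₁], [q₂, q₁]] = false := by
  simp [expectsStructural, h₁, h₂]

/-- «BARE ∣ COMPOUND» IN CLOSED FORM. Against `[[q₁], [q₂, q₁]]` (`q₁`, `q₂` non-structural) the print `p :: tl` scores:
structural `p` ⇒ `ABSTAIN_structure`; `p = q₁`, or `p = q₂` with `q₁ ∈ tl` ⇒ `AGREE`; otherwise `PARTIAL` iff `p = q₂` or `q₁ ∈ tl`
or `q₂ ∈ tl`, else `DISAGREE`. [folklore] -/
theorem outcome_bare_compound (p q₁ q₂ : α) (tl : List α) (h₁ : structural q₁ = false) (h₂ : structural q₂ = false) :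
    outcome structural (p :: tl) [[q₁], [q₂, q₁]] =
      (if structural p then .ABSTAIN_structure
       else if p = q₁ ∨ (p = q₂ ∧ q₁ ∈ tl) then .AGREE
       else if p = q₂ ∨ q₁ ∈ tl ∨ q₂ ∈ tl then .PARTIAL else .DISAGREE) := by
  have hexp := expectsStructural_bare_compound structural h₁ h₂
  have halts : ([[q₁], [q₂, q₁]] : List (List α)) ≠ [] := by simp
  by_cases hs : structural p = true
  · rw [if_pos hs]
    exact outcome_structural_abstain structural halts hs hexp
  rw [if_neg hs]
  have hs' : structural p = false := by simpa using hs
  have hgate : (structural p && !expectsStructural structural [[q₁], [q₂, q₁]]) = false := by rw [hs']; rfl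
  by_cases hp : p = q₁ ∨ (p = q₂ ∧ q₁ ∈ tl)
  · rw [if_pos hp, outcome_eq_agree_iff structural halts hgate]
    rcases hp with rfl | ⟨rfl, he⟩
    · exact ⟨[p], by simp, by simp [fullMatch, covers]⟩
    · exact ⟨[p, q₁], by simp, by simp [fullMatch, covers, he]⟩
  rw [if_neg hp]
  rw [not_or, not_and_or] at hp
  have hp₁ : p ≠ q₁ := hp.1
  have hnofull : ∀ a ∈ ([[q₁], [q₂, q₁]] : List (List α)), fullMatch (p :: tl) a = false := by
    intro a ha
    simp only [List.mem_cons, List.not_mem_nil, or_false] at ha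
    rcases ha with rfl | rfl
    · exact fullMatch_cons_eq_false_of_ne hp₁
    · rcases hp.2 with hh | he
      · exact fullMatch_cons_eq_false_of_ne hh
      · exact fullMatch_eq_false_of_missing (List.mem_cons_of_mem _ (List.mem_singleton_self _))
          (fun hm => by
            rcases List.mem_cons.1 hm with h | h
            · exact hp₁ h.symm
            · exact he h)
  by_cases hm : p = q₂ ∨ q₁ ∈ tl ∨ q₂ ∈ tl
  · rw [if_pos hm]
    refine outcome_eq_partial_of structural halts hgate hnofull ?_
    rcases hm with rfl | hm | hm
    · exact ⟨[p, q₁], by simp, by rw [primaryEmitted_cons']; simp⟩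
    · exact ⟨[q₁], by simp, by rw [primaryEmitted_cons']; simp [hm]⟩
    · exact ⟨[q₂, q₁], by simp, by rw [primaryEmitted_cons']; simp [hm]⟩
  · rw [if_neg hm]
    rw [not_or, not_or] at hm
    have hne₁ : q₁ ≠ p := fun h => hp₁ h.symm
    have hne₂ : q₂ ≠ p := fun h => hm.1 h.symm
    have hm₁ : q₁ ∉ tl := hm.2.1
    have hm₂ : q₂ ∉ tl := hm.2.2
    refine outcome_eq_disagree_of_no_primary_emitted structural halts hgate ?_
    intro a ha
    simp only [List.mem_cons, List.not_mem_nil, or_false] at ha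
    rcases ha with rfl | rfl
    · rw [primaryEmitted_cons']; simp [hm₁, hne₁]
    · rw [primaryEmitted_cons']; simp [hm₂, hne₂]

/-- … `AGREE` iff led by the bare head, or led by the compound head WITH the bare head riding. [folklore] -/
theorem bare_compound_agree_iff (p q₁ q₂ : α) (tl : List α) (h₁ : structural q₁ = false) (h₂ : structural q₂ = false) :
    outcome structural (p :: tl) [[q₁], [q₂, q₁]] = .AGREE ↔ p = q₁ ∨ (p = q₂ ∧ q₁ ∈ tl) := by
  rw [outcome_bare_compound structural p q₁ q₂ tl h₁ h₂]
  by_cases hs : structural p = true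
  · rw [if_pos hs]; constructor
    · intro h; exact absurd h (by decide)
    · rintro (rfl | ⟨rfl, _⟩)
      · rw [h₁] at hs; exact absurd hs (by decide)
      · rw [h₂] at hs; exact absurd hs (by decide)
  rw [if_neg hs]
  by_cases hp : p = q₁ ∨ (p = q₂ ∧ q₁ ∈ tl)
  · rw [if_pos hp]; exact ⟨fun _ => hp, fun _ => rfl⟩
  rw [if_neg hp]
  by_cases hm : p = q₂ ∨ q₁ ∈ tl ∨ q₂ ∈ tl
  · rw [if_pos hm]; exact ⟨fun h => absurd h (by decide), fun h => absurd h hp⟩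
  · rw [if_neg hm]; exact ⟨fun h => absurd h (by decide), fun h => absurd h hp⟩

end general

open Head

/-! ## §2 The instances on the router's heads: «EPH ∣ UND:MULTIORB+EPH» (PbMo₆S₈) and EPHMIX re-derived -/

/-- the PbMo₆S₈ typing as filed (truth M154): «EPH ∣ UND:MULTIORB+EPH». [folklore] -/
def ephMulti : List (List Head) := [[eph], [undMultiorb, eph]]

/-- «EPH ∣ UND:MULTIORB+EPH» IN CLOSED FORM (§1 with `q₁ = EPH`, `q₂ = UND:MULTIORB`). [folklore] -/
theorem score_ephMulti (p : Head) (tl : List Head) :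
    score (p :: tl) ephMulti =
      (if p.structural then .ABSTAIN_structure
       else if p = eph ∨ (p = undMultiorb ∧ eph ∈ tl) then .AGREE
       else if p = undMultiorb ∨ eph ∈ tl ∨ undMultiorb ∈ tl then .PARTIAL else .DISAGREE) :=
  outcome_bare_compound Head.structural p eph undMultiorb tl rfl rfl

/-- PbMo₆S₈: `AGREE` iff led by «EPH», or led by the Mo k-head «UND:MULTIORB» with «EPH» riding. [folklore] -/
theorem ephMulti_agree_iff (p : Head) (tl : List Head) :
    score (p :: tl) ephMulti = .AGREE ↔ p = eph ∨ (p = undMultiorb ∧ eph ∈ tl) :=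
  bare_compound_agree_iff Head.structural p eph undMultiorb tl rfl rfl

/-- EPHMIX RE-DERIVED FROM §1 (consistency with p764933 `score_ephmix`): the two closed forms coincide on every print. [folklore] -/
theorem score_ephmix_again (p : Head) (tl : List Head) :
    score (p :: tl) ephmix =
      (if p.structural then .ABSTAIN_structure
       else if p = eph ∨ (p = undMixed ∧ eph ∈ tl) then .AGREE
       else if p = undMixed ∨ eph ∈ tl ∨ undMixed ∈ tl then .PARTIAL else .DISAGREE) :=
  outcome_bare_compound Head.structural p eph undMixed tl rfl rfl

/-- The block57 desk table for M154 PbMo₆S₈ by `decide` (registered at CLAIM stage, before any number): «EPH», «EPH+SA»,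
«UND:MULTIORB+EPH» ⇒ AGREE; the rider-less k-head «UND:MULTIORB», the Mo-4d straddle «UND:MIXED+EPH» (the pre-named live shape),
«UND:MIXED+UND:MULTIORB+EPH», «UND:HF+EPH» ⇒ PARTIAL; «UND:MIXED» alone, «BI» ⇒ DISAGREE; a structure-LED print ⇒ ABSTAIN(structure).
[folklore] -/
theorem block57_pbmo6s8_table :
    score [eph] ephMulti = .AGREE ∧ score [eph, sa] ephMulti = .AGREE ∧ score [undMultiorb, eph] ephMulti = .AGREE ∧
    score [undMultiorb] ephMulti = .PARTIAL ∧ score [undMixed, eph] ephMulti = .PARTIAL ∧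
    score [undMixed, undMultiorb, eph] ephMulti = .PARTIAL ∧ score [undHF, eph] ephMulti = .PARTIAL ∧
    score [undMixed] ephMulti = .DISAGREE ∧ score [bi] ephMulti = .DISAGREE ∧
    score [undStruct, eph] ephMulti = .ABSTAIN_structure := by
  decide

/-! ## §3 What the choice between the two instances decides -/

/-- THE k-HEAD PRINT «UND:MULTIORB(…)+EPH» is AGREE under «EPH ∣ UND:MULTIORB+EPH» and PARTIAL under EPHMIX; THE STRADDLE PRINT
«UND:MIXED(…)+EPH» is the mirror image — so typing PbMo₆S₈ with the k-head compound (and ThIr₃ with the straddle compound) is exactly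
the statement of which d-head reading is expected to AGREE; a bare «EPH» is AGREE under both and tells them apart from neither.
[folklore] -/
theorem khead_vs_straddle_typing (tl : List Head) :
    score (undMultiorb :: eph :: tl) ephMulti = .AGREE ∧ score (undMultiorb :: eph :: tl) ephmix = .PARTIAL ∧
    score (undMixed :: eph :: tl) ephmix = .AGREE ∧ score (undMixed :: eph :: tl) ephMulti = .PARTIAL ∧
    score (eph :: tl) ephMulti = .AGREE ∧ score (eph :: tl) ephmix = .AGREE := by
  refine ⟨?_, ?_, ?_, ?_, ?_, ?_⟩
  · exact (ephMulti_agree_iff _ _).2 (Or.inr ⟨rfl, List.mem_cons_self⟩)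
  · rw [score_ephmix_again]; simp [Head.structural]
  · rw [score_ephmix_again]; simp [Head.structural]
  · rw [score_ephMulti]; simp [Head.structural]
  · exact (ephMulti_agree_iff _ _).2 (Or.inl rfl)
  · rw [score_ephmix_again]; simp [Head.structural]

end RouterScore

end Summit.Ventures.CertifiedManyBodySolver.Downfold
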